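import Summits.HubbardSuperconductivity.HubbardSuperconductivity.Theses.NodalDiracTwist
import Summits.HubbardSuperconductivity.HubbardSuperconductivity.Theses.AposterioriCapRg
import Summits.HubbardSuperconductivity.HubbardSuperconductivity.Theorems.NodalDiracTwistBridgeNodalToDWaveNDSpeaksFrequently
import Summits.HubbardSuperconductivity.HubbardSuperconductivity.Theorems.NodalDiracTwistBridgeNodalToDWaveUniqueGroundState
import Summits.HubbardSuperconductivity.HubbardSuperconductivity.Theorems.NodalDiracTwistBridgeNodalToDWaveSubsequenceOrderForcesSSB
import Summits.HubbardSuperconductivity.HubbardSuperconductivity.Theorems.NodalDiracTwistBridgeNodalToDWaveEnergyMatching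
import Summits.HubbardSuperconductivity.HubbardSuperconductivity.Theorems.NodalDiracTwistBridgeNodalToDWaveSourcedEnergyDensityLimit
import Summits.HubbardSuperconductivity.HubbardSuperconductivity.Theorems.WeakCouplingBCSWcbcsBcsConstructionEnergyDensityLimit
import Literature.MathematicalPhysics.QuantumLattice.HubbardGrandCanonicalDensity
import Literature.MathematicalPhysics.QuantumLattice.SpinTwistedHubbardTorus
import Literature.MathematicalPhysics.QuantumLattice.DWaveSource
import Literature.MathematicalPhysics.QuantumLattice.PairCorrelationsProofs
import Literature.MathematicalPhysics.QuantumLattice.LatticeToriLROProofs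

/-!
# Conditional compositions of line `birth` for the crux `BridgeNodalToDWave`
# (item stmt-HubbardSuperconductivity-10395, route NodalDiracTwist) — CONDITIONAL results

The crux `BridgeNodalToDWave := ∃ U₀ > 0, ∀ U ∈ (0,U₀), ∀ δ ∈ [1/10,3/10], ND(U,δ) → LRO(U,δ)`
(`ND` = the route's nodal-Dirac package of the spin-twisted torus; `LRO` = the Statement's even-side
`d_{x²−y²}` pair-field long-range order of EVERY normalised sector ground-state sequence).  Leads c1–c9
of line `birth` (skeleton `Cruxes/BridgeNodalToDWave/Lines/birth.lean`, sha 6e823d63d553) reduced the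
crux to five LANDED stubs (A `stub_ndSpeaksFrequently` p141870, B `stub_uniqueGroundStateOfPackage`
p141864, D1 `stub_subsequenceOrderForcesSSB` p142988, D3a `stub_sourcedEnergyDensityLimit` p143420,
D3b `stub_energyMatchingOfDensityMatching` p143074) plus three OPEN inputs, none of which is a lemma
awaiting technique:

* (C) the per-volume CLASSIFICATION CORE — "diagonal Dirac quartet with holonomy `−1` of the
  `(N_L,0)`-sector ground-state bundle of `spinTwistedHubbardTorus L U ·` + unique untwisted sector
  ground state ⇒ `c₀ L⁴ ≤ re⟨χ, Δ_d†Δ_d χ⟩` for every normalised sector ground state `χ` of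
  `hubbardTorus 2 L 1 U`", constants uniform in the side: the crux's entire physical content, a
  folklore conjecture (named competitor: the nodal liquid, Balents–Fisher–Nayak 1998);
* (EOS) regularity of the `T = 0` grand-canonical equation of state of the weakly repulsive model across
  densities `[7/10, 9/10]` (no first-order density jump; shared residue of cruxes stmt-2010, stmt-1315);
* the transfer crux `Theses.AposterioriCapRg.SsbToEvenTorusLro` (stmt-HubbardSuperconductivity-1315;
  Koma–Tasaki order under an infinitesimal pair field ⇒ the Statement's LRO for every admissible family).

This file puts the line's sorry-free COMPOSITIONS into the tree as explicitly CONDITIONAL theorems (the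
hypotheses are spelled out verbatim — (C) and (EOS) are the registered stub signatures
`stub_classificationCore`, `stub_regularEquationOfStateIcc` of the crux; nothing is asserted):

* `lroSeq_succ_eq_expect'` — one term of the Statement's LRO sequence at side `L+1` is
  `re⟨ψ_{L+1}, Δ_g†Δ_g ψ_{L+1}⟩/(L+1)⁴`;
* `densityMatched_of_regularEOS` — (EOS) ⇒ for every `δ ∈ [1/10,3/10]` a density-matched chemical
  potential (the hypothesis (DM) of `SsbToEvenTorusLro`), by Darboux + Griffiths
  (`exists_tendsto_gcDensity_of_regularWindow`) and the grand-canonical thermodynamic limit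
  `stub_torusGcEnergyDensityLimit`;
* `nodalOrderAlongSubsequence_of_classificationCore` — (C) ⇒ [`ND(U,δ)` ⇒ every admissible family has
  `F_ψ(k) ≥ c₀` for INFINITELY MANY `k`]: what the route's mechanism delivers with no thermodynamic input
  (A: `ND` speaks on infinitely many even sides; B: where it speaks the untwisted sector ground state is
  unique; C: the floor).  The resonant sides `dist(Lκ, πℤ) < ε`, on which `ND` is silent, are exactly what
  separates this from `LRO` (a `liminf` over ALL even sides);
* `bridgeNodalToDWave_of_classificationCore` — (C) → (EOS) → `SsbToEvenTorusLro` → `BridgeNodalToDWave`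
  BY NAME (frequent order ⇒ Koma–Tasaki order `HasDWaveOrder U μ` at a density-matched `μ` by D1 with
  D3a/D3b, then the transfer crux).  This is the closing `exact` of the CONDITIONAL bridge foreseen by
  the route's kill criteria ("Bridge refuted … → pivot to a conditional bridge").

Sources: Scalapino, Phys. Rep. 250 (1995) 329, §2 eq. (2.4); Koma–Tasaki, J. Stat. Phys. 76 (1994) 745,
Thm 2.3; Ruelle (1969) §3.4; ArovasBergKivelsonRaghu2022 §5.1.  No new definitions.
Supports the crux (`--supports stmt-HubbardSuperconductivity-10395`); closes nothing.
-/

-- the mandated namespace repeats `HubbardSuperconductivity` (single-problem summit, D-0017)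
set_option linter.dupNamespace false

namespace Summit.HubbardSuperconductivity.HubbardSuperconductivity.Theorems.NodalDiracTwist.BridgeNodalToDWave

open Filter Finset Matrix
open Literature.Probability.LatticeModels Literature.MathematicalPhysics.QuantumLattice
open Summit.HubbardSuperconductivity.HubbardSuperconductivity.Theses.NodalDiracTwist
open scoped ComplexOrder Topology

/-- One term of the Statement's LRO sequence at side `L + 1` is the normalised pair-field
expectation `re ⟨ψ_{L+1}, Δ_g† Δ_g ψ_{L+1}⟩ / (L+1)⁴`: this is
`Literature.MathematicalPhysics.QuantumLattice.torusLROSeq_pairFieldCorr_succ`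
(`PairCorrelationsProofs.lean`; deprecated duplicate kept as an alias, dedup-03051). [folklore] -/
@[deprecated torusLROSeq_pairFieldCorr_succ (since := "2026-08-17")]
alias lroSeq_succ_eq_expect' := torusLROSeq_pairFieldCorr_succ

/-- **Regular equation of state ⇒ a density-matched chemical potential for every doping in the window.**
If for all small `U > 0` the limiting grand-canonical ground-energy density
`ν ↦ lim_L E₀(hubbardTorusWith 2 (L+1) 1 U ν)/(L+1)²` is differentiable on a `μ`-window whose end
densities bracket `[7/10, 9/10]` (hypothesis = the registered stub `stub_regularEquationOfStateIcc`, OPEN),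
then for every `δ ∈ [1/10,3/10]` some `μ` has grand-canonical ground-state density `→ 1 − δ`
(Darboux + Griffiths: `exists_tendsto_gcDensity_of_regularWindow`, with the thermodynamic limit
`stub_torusGcEnergyDensityLimit`). CONDITIONAL on its hypothesis. Ruelle (1969) §3.4; Koma–Tasaki (1994) §1. [folklore] -/
theorem densityMatched_of_regularEOS
    (hreg :
      ∃ U₂ : ℝ, 0 < U₂ ∧ ∀ U ∈ Set.Ioo (0 : ℝ) U₂, ∃ (e' : ℝ → ℝ) (μ₁ μ₂ : ℝ), μ₁ ≤ μ₂ ∧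
      (∀ μ' ∈ Set.Icc μ₁ μ₂, HasDerivAt (fun ν : ℝ => limUnder Filter.atTop (fun L : ℕ =>
      (Literature.MathematicalPhysics.QuantumLattice.hubbardTorusWith 2 (L + 1) 1 U ν).groundEnergy /
      ((L + 1 : ℕ) : ℝ) ^ 2)) (e' μ') μ') ∧
      -e' μ₁ ≤ 1 - 3 / 10 ∧ 1 - 1 / 10 ≤ -e' μ₂) :
    ∃ U₂ : ℝ, 0 < U₂ ∧ ∀ U ∈ Set.Ioo (0 : ℝ) U₂, ∀ δ ∈ Set.Icc (1 / 10 : ℝ) (3 / 10), ∃ μ : ℝ,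
    Filter.Tendsto (fun L : ℕ => ((hubbardTorusWith 2 (L + 1) 1 U μ).groundStateFunctional
      totalNumber).re / ((L + 1 : ℕ) : ℝ) ^ 2) Filter.atTop (nhds (1 - δ)) := by
  obtain ⟨U₂, hU₂, hwin⟩ := hreg
  refine ⟨U₂, hU₂, fun U hU δ hδ => ?_⟩
  obtain ⟨e', μ₁, μ₂, h12, hder, h₁, h₂⟩ := hwin U hU
  have hlim : ∀ μ' : ℝ, Tendsto (fun L : ℕ => (hubbardTorusWith 2 (L + 1) 1 U μ').groundEnergy /
      ((L + 1 : ℕ) : ℝ) ^ 2) atTop (nhds ((fun ν : ℝ => limUnder atTop (fun L : ℕ =>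
        (hubbardTorusWith 2 (L + 1) 1 U ν).groundEnergy / ((L + 1 : ℕ) : ℝ) ^ 2)) μ')) := fun μ' =>
    tendsto_nhds_limUnder
      (Summit.HubbardSuperconductivity.HubbardSuperconductivity.Theorems.stub_torusGcEnergyDensityLimit U μ')
  obtain ⟨μ, -, hμ⟩ := exists_tendsto_gcDensity_of_regularWindow 1 U h12 hlim hder h₁ h₂ hδ
  exact ⟨μ, hμ⟩

/-- **Classification core ⇒ nodal order along a subsequence** (CONDITIONAL on (C)).  If (C) the
per-volume classification core holds — verbatim the registered stub `stub_classificationCore`: at every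
large even side, a diagonal Dirac quartet with holonomy `−1` of the `(N_L,0)`-sector ground-state bundle
of `spinTwistedHubbardTorus L U ·` together with a unique untwisted sector ground state forces
`c₀ L⁴ ≤ re⟨χ, Δ_d†Δ_d χ⟩` — then the crux's hypothesis `ND(U,δ)` (VERBATIM) gives every admissible
family `(N, ψ)` (the Statement's hypothesis VERBATIM) the `d`-wave pair-order floor `c₀ ≤ F_ψ(k)` for
INFINITELY MANY `k`: `ND` speaks on infinitely many even sides (`stub_ndSpeaksFrequently`), where it
speaks `φ = 0` is off the locus (`c > 0`) so the untwisted ground state is unique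
(`stub_uniqueGroundStateOfPackage`, `spinTwistedHubbardTorus` is `rfl` to the inlined family), and (C)
gives the floor at side `L = 2k`.  Scalapino, Phys. Rep. 250 (1995) 329, §2; ArovasBergKivelsonRaghu2022 §5.1. [folklore] -/
theorem nodalOrderAlongSubsequence_of_classificationCore :
    (∃ U₀ : ℝ, 0 < U₀ ∧ ∀ U ∈ Set.Ioo (0 : ℝ) U₀,
      ∀ δ ∈ Set.Icc (1 / 10 : ℝ) (3 / 10), ∃ c₀ : ℝ, 0 < c₀ ∧ ∃ L₁ : ℕ, ∀ (L : ℕ) [NeZero L],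
      Even L → L₁ ≤ L →
      (∃ c : ℝ, 0 < c ∧ c < Real.pi ∧
      (∀ φ : Fin 2 → ℝ, φ 0 ∈ Set.Ioc (-Real.pi) Real.pi → φ 1 ∈ Set.Ioc (-Real.pi) Real.pi →
      ((∃ ψ₁ ψ₂ : Literature.MathematicalPhysics.QuantumLattice.Fock
      (Literature.MathematicalPhysics.QuantumLattice.Orb
      (Literature.MathematicalPhysics.QuantumLattice.FermionTorus 2 L)),
      Literature.MathematicalPhysics.QuantumLattice.IsGroundStateInSector
      (Literature.MathematicalPhysics.QuantumLattice.spinTwistedHubbardTorus L U φ)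
      (2 * ⌊(1 - δ) * (L : ℝ) ^ 2 / 2⌋₊) 0 ψ₁ ∧
      Literature.MathematicalPhysics.QuantumLattice.IsGroundStateInSector
      (Literature.MathematicalPhysics.QuantumLattice.spinTwistedHubbardTorus L U φ)
      (2 * ⌊(1 - δ) * (L : ℝ) ^ 2 / 2⌋₊) 0 ψ₂ ∧
      star ψ₁ ⬝ᵥ ψ₂ = 0) ↔ (|φ 0| = c ∧ |φ 1| = c))) ∧
      (∀ p : Fin 2 → ℝ, |p 0| = c → |p 1| = c → ∀ r : ℝ, 0 < r → r < min c (Real.pi - c) →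
      ∃ n₀ : ℕ, ∀ n ≥ n₀, ∀ ψ : Fin n → Literature.MathematicalPhysics.QuantumLattice.Fock
      (Literature.MathematicalPhysics.QuantumLattice.Orb
      (Literature.MathematicalPhysics.QuantumLattice.FermionTorus 2 L)),
      (∀ i : Fin n, Literature.MathematicalPhysics.QuantumLattice.IsGroundStateInSector
      (Literature.MathematicalPhysics.QuantumLattice.spinTwistedHubbardTorus L U
      (fun ν : Fin 2 => p ν + r * (if ν = 0 then Real.cos (2 * Real.pi * (i : ℕ) / n)
      else Real.sin (2 * Real.pi * (i : ℕ) / n))))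
      (2 * ⌊(1 - δ) * (L : ℝ) ^ 2 / 2⌋₊) 0 (ψ i) ∧ star (ψ i) ⬝ᵥ ψ i = 1) →
      (∏ i : Fin n, star (ψ i) ⬝ᵥ ψ (finRotate n i)).re < 0)) →
      (∀ χ₁ χ₂ : Literature.MathematicalPhysics.QuantumLattice.Fock
      (Literature.MathematicalPhysics.QuantumLattice.Orb
      (Literature.MathematicalPhysics.QuantumLattice.FermionTorus 2 L)),
      Literature.MathematicalPhysics.QuantumLattice.IsGroundStateInSector
      (Literature.MathematicalPhysics.QuantumLattice.hubbardTorus 2 L 1 U)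
      (2 * ⌊(1 - δ) * (L : ℝ) ^ 2 / 2⌋₊) 0 χ₁ →
      Literature.MathematicalPhysics.QuantumLattice.IsGroundStateInSector
      (Literature.MathematicalPhysics.QuantumLattice.hubbardTorus 2 L 1 U)
      (2 * ⌊(1 - δ) * (L : ℝ) ^ 2 / 2⌋₊) 0 χ₂ →
      ∃ z : ℂ, χ₂ = z • χ₁) →
      ∀ χ : Literature.MathematicalPhysics.QuantumLattice.Fock
      (Literature.MathematicalPhysics.QuantumLattice.Orb
      (Literature.MathematicalPhysics.QuantumLattice.FermionTorus 2 L)),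
      Literature.MathematicalPhysics.QuantumLattice.IsGroundStateInSector
      (Literature.MathematicalPhysics.QuantumLattice.hubbardTorus 2 L 1 U)
      (2 * ⌊(1 - δ) * (L : ℝ) ^ 2 / 2⌋₊) 0 χ →
      star χ ⬝ᵥ χ = 1 →
      c₀ * (L : ℝ) ^ 4 ≤ (Literature.MathematicalPhysics.QuantumLattice.expect
      ((Literature.MathematicalPhysics.QuantumLattice.pairField
      Literature.MathematicalPhysics.QuantumLattice.dWaveFormFactor L)ᴴ *
      Literature.MathematicalPhysics.QuantumLattice.pairField
      Literature.MathematicalPhysics.QuantumLattice.dWaveFormFactor L) χ).re) →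
    ∃ U₀ : ℝ, 0 < U₀ ∧ ∀ U ∈ Set.Ioo (0 : ℝ) U₀, ∀ δ ∈ Set.Icc (1 / 10 : ℝ) (3 / 10),
    (∃ κ : ℝ, 0 < κ ∧ κ < Real.pi ∧ Real.cos κ ≠ 0 ∧ ∀ ε : ℝ, 0 < ε → ∃ L₀ : ℕ, ∀ (L : ℕ) [NeZero
    L], Even L → L₀ ≤ L → (∀ m : ℤ, ε ≤ |L * κ - m * Real.pi|) →
    let sh : Literature.MathematicalPhysics.QuantumLattice.FermionTorus 2 L → Fin 2 → Literature.MathematicalPhysics.QuantumLattice.FermionTorus 2 L := fun x μ => toLex (Function.update (ofLex x) μ (ofLex x μ + 1));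
    let a := fun (x : Literature.MathematicalPhysics.QuantumLattice.FermionTorus 2 L) (σ : Fin 2) => Literature.MathematicalPhysics.QuantumLattice.annihilation (Literature.MathematicalPhysics.QuantumLattice.orb x σ);
    let H := fun φ : Fin 2 → ℝ => -(∑ x : Literature.MathematicalPhysics.QuantumLattice.FermionTorus 2 L, ∑ μ : Fin 2, ∑ σ : Fin 2, (Complex.exp (Complex.I * (((-1 : ℝ) ^ (σ : ℕ) * φ μ / L : ℝ) : ℂ)) • (Matrix.conjTranspose (a x σ) * a (sh x μ) σ) + Complex.exp (-(Complex.I * (((-1 : ℝ) ^ (σ : ℕ) * φ μ / L : ℝ) : ℂ))) • (Matrix.conjTranspose (a (sh x μ) σ) * a x σ))) + (U : ℂ) • ∑ x : Literature.MathematicalPhysics.QuantumLattice.FermionTorus 2 L, Literature.MathematicalPhysics.QuantumLattice.numberOp x 0 * Literature.MathematicalPhysics.QuantumLattice.numberOp x 1;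
    ∃ c : ℝ, 0 < c ∧ c < Real.pi ∧ |Real.cos c - Real.cos (L * κ)| ≤ ε ∧ (∀ φ : Fin 2 → ℝ, φ 0 ∈
    Set.Ioc (-Real.pi) Real.pi → φ 1 ∈ Set.Ioc (-Real.pi) Real.pi → ((∃ ψ₁ ψ₂,
    Literature.MathematicalPhysics.QuantumLattice.IsGroundStateInSector (H φ) (2 * ⌊(1 - δ) * (L :
    ℝ) ^ 2 / 2⌋₊) 0 ψ₁ ∧ Literature.MathematicalPhysics.QuantumLattice.IsGroundStateInSector (H φ)
    (2 * ⌊(1 - δ) * (L : ℝ) ^ 2 / 2⌋₊) 0 ψ₂ ∧ star ψ₁ ⬝ᵥ ψ₂ = 0) ↔ (|φ 0| = c ∧ |φ 1| = c))) ∧ (∀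
    p : Fin 2 → ℝ, |p 0| = c → |p 1| = c → ∀ r : ℝ, 0 < r → r < min c (Real.pi - c) → ∃ n₀ : ℕ, ∀
    n ≥ n₀, ∀ ψ : Fin n → (Finset (Literature.MathematicalPhysics.QuantumLattice.Orb
    (Literature.MathematicalPhysics.QuantumLattice.FermionTorus 2 L)) → ℂ), (∀ i : Fin n,
    Literature.MathematicalPhysics.QuantumLattice.IsGroundStateInSector (H (fun ν : Fin 2 => p ν +
    r * (if ν = 0 then Real.cos (2 * Real.pi * (i : ℕ) / n) else Real.sin (2 * Real.pi * (i : ℕ) /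
    n)))) (2 * ⌊(1 - δ) * (L : ℝ) ^ 2 / 2⌋₊) 0 (ψ i) ∧ star (ψ i) ⬝ᵥ ψ i = 1) → (∏ i : Fin n, star
    (ψ i) ⬝ᵥ ψ (finRotate n i)).re < 0)) →
    ∀ (N : ℕ → ℕ) (ψ : ∀ L, Literature.MathematicalPhysics.QuantumLattice.Fock
    (Literature.MathematicalPhysics.QuantumLattice.Orb
    (Literature.MathematicalPhysics.QuantumLattice.FermionTorus 2 L))), (∀ L, Even L → N L = 2 * ⌊(1
    - δ) * (L : ℝ) ^ 2 / 2⌋₊ ∧ star (ψ L) ⬝ᵥ ψ L = 1 ∧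
    Literature.MathematicalPhysics.QuantumLattice.IsGroundStateInSector
    (Literature.MathematicalPhysics.QuantumLattice.hubbardTorus 2 L 1 U) (N L) 0 (ψ L)) →
    ∃ c : ℝ, 0 < c ∧ ∃ᶠ k : ℕ in Filter.atTop, c ≤ (∑ x ∈
    Literature.Probability.LatticeModels.halfOpenBox 2 (2 * k), ∑ y ∈
    Literature.Probability.LatticeModels.halfOpenBox 2 (2 * k),
    Literature.MathematicalPhysics.QuantumLattice.torusPullback
    (Literature.MathematicalPhysics.QuantumLattice.pairFieldCorr
    Literature.MathematicalPhysics.QuantumLattice.dWaveFormFactor ψ) (2 * k) x y) /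
    ((Literature.Probability.LatticeModels.halfOpenBox 2 (2 * k)).card : ℝ) ^ 2 := by
  intro hC
  have hA := stub_ndSpeaksFrequently
  have hB := stub_uniqueGroundStateOfPackage
  obtain ⟨U₀, hU₀, hC⟩ := hC
  refine ⟨U₀, hU₀, ?_⟩
  intro U hU δ hδ hND N ψ hyp
  obtain ⟨κ, hκ0, hκπ, hcos, hND⟩ := hND
  obtain ⟨c₀, hc₀, L₁, hC⟩ := hC U hU δ hδ
  obtain ⟨ε, hε, hA⟩ := hA κ hκ0 hκπ hcos
  obtain ⟨L₀, hND⟩ := hND ε hε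
  refine ⟨c₀, hc₀, Filter.frequently_atTop.2 fun a => ?_⟩
  obtain ⟨L, hLge, hLeven, hLres⟩ := hA (max (2 * a) (max L₀ (max L₁ 3)))
  have haL : 2 * a ≤ L := le_trans (le_max_left _ _) hLge
  have hL0 : L₀ ≤ L := le_trans (le_trans (le_max_left _ _) (le_max_right _ _)) hLge
  have hL1 : L₁ ≤ L := le_trans (le_trans (le_trans (le_max_left _ _) (le_max_right _ _))
    (le_max_right _ _)) hLge
  have hL3 : 3 ≤ L := le_trans (le_trans (le_trans (le_max_right _ _) (le_max_right _ _))
    (le_max_right _ _)) hLge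
  obtain ⟨k, hk⟩ := hLeven
  have hLk : L = 2 * k := by omega
  refine ⟨k, by omega, ?_⟩
  haveI : NeZero L := ⟨by omega⟩
  -- the package clause at side `L`
  obtain ⟨c, hc0, hcπ, -, hI, hII⟩ := hND L ⟨k, hk⟩ hL0 hLres
  -- (B): uniqueness of the untwisted sector ground state, from clause (I) at `φ = 0`
  have hnot : ¬ ∃ ψ₁ ψ₂ : Fock (Orb (FermionTorus 2 L)),
      IsGroundStateInSector (spinTwistedHubbardTorus L U 0) (2 * ⌊(1 - δ) * (L : ℝ) ^ 2 / 2⌋₊) 0 ψ₁ ∧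
      IsGroundStateInSector (spinTwistedHubbardTorus L U 0) (2 * ⌊(1 - δ) * (L : ℝ) ^ 2 / 2⌋₊) 0 ψ₂ ∧
      star ψ₁ ⬝ᵥ ψ₂ = 0 := by
    intro hex
    have h0 : (0 : Fin 2 → ℝ) 0 ∈ Set.Ioc (-Real.pi) Real.pi :=
      ⟨by simpa using Real.pi_pos, by simpa using Real.pi_pos.le⟩
    have h := (hI 0 h0 h0).1 hex
    simp only [Pi.zero_apply, abs_zero] at h
    exact absurd h.1 (ne_of_lt hc0)
  have huniq := hB L hL3 U (2 * ⌊(1 - δ) * (L : ℝ) ^ 2 / 2⌋₊) hnot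
  -- (C): the pair-order floor at side `L`
  have hfloor := hC L ⟨k, hk⟩ hL1 ⟨c, hc0, hcπ, hI, hII⟩ huniq
  obtain ⟨hN, hnormL, hGS⟩ := hyp L ⟨k, hk⟩
  rw [hN] at hGS
  have hle := hfloor (ψ L) hGS hnormL
  -- rewrite the `k`-th term of the LRO sequence (side `2k = (2k-1)+1`) as the normalised expectation
  obtain ⟨L', hL'⟩ : ∃ L' : ℕ, 2 * k = L' + 1 := ⟨2 * k - 1, by omega⟩
  rw [hL', torusLROSeq_pairFieldCorr_succ, le_div_iff₀ (by positivity)]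
  have hLL' : L = L' + 1 := by omega
  subst hLL'
  exact hle

/-- **The conditional bridge** (CONDITIONAL on (C), (EOS) and the transfer crux stmt-1315).  From
(C) the classification core (verbatim the registered stub `stub_classificationCore`), (EOS) regularity of
the `T = 0` grand-canonical equation of state on a window (verbatim the registered stub
`stub_regularEquationOfStateIcc`) and the transfer crux `Theses.AposterioriCapRg.SsbToEvenTorusLro`
(stmt-HubbardSuperconductivity-1315), the crux `BridgeNodalToDWave` follows BY NAME:
`nodalOrderAlongSubsequence_of_classificationCore` gives frequent `d`-wave order of the given admissible
family; (EOS) supplies a density-matched `μ` (`densityMatched_of_regularEOS`), which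
`stub_energyMatchingOfDensityMatching` turns into energy matching; with the sourced thermodynamic limit
`stub_sourcedEnergyDensityLimit`, `stub_subsequenceOrderForcesSSB` (Koma–Tasaki forward leg) yields
`HasDWaveOrder U μ`; the transfer crux returns the Statement's LRO for every admissible family.
Koma–Tasaki, J. Stat. Phys. 76 (1994) 745, Thm 2.3; Scalapino (1995) §2. [folklore] -/
theorem bridgeNodalToDWave_of_classificationCore :
    (∃ U₀ : ℝ, 0 < U₀ ∧ ∀ U ∈ Set.Ioo (0 : ℝ) U₀,
      ∀ δ ∈ Set.Icc (1 / 10 : ℝ) (3 / 10), ∃ c₀ : ℝ, 0 < c₀ ∧ ∃ L₁ : ℕ, ∀ (L : ℕ) [NeZero L],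
      Even L → L₁ ≤ L →
      (∃ c : ℝ, 0 < c ∧ c < Real.pi ∧
      (∀ φ : Fin 2 → ℝ, φ 0 ∈ Set.Ioc (-Real.pi) Real.pi → φ 1 ∈ Set.Ioc (-Real.pi) Real.pi →
      ((∃ ψ₁ ψ₂ : Literature.MathematicalPhysics.QuantumLattice.Fock
      (Literature.MathematicalPhysics.QuantumLattice.Orb
      (Literature.MathematicalPhysics.QuantumLattice.FermionTorus 2 L)),
      Literature.MathematicalPhysics.QuantumLattice.IsGroundStateInSector
      (Literature.MathematicalPhysics.QuantumLattice.spinTwistedHubbardTorus L U φ)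
      (2 * ⌊(1 - δ) * (L : ℝ) ^ 2 / 2⌋₊) 0 ψ₁ ∧
      Literature.MathematicalPhysics.QuantumLattice.IsGroundStateInSector
      (Literature.MathematicalPhysics.QuantumLattice.spinTwistedHubbardTorus L U φ)
      (2 * ⌊(1 - δ) * (L : ℝ) ^ 2 / 2⌋₊) 0 ψ₂ ∧
      star ψ₁ ⬝ᵥ ψ₂ = 0) ↔ (|φ 0| = c ∧ |φ 1| = c))) ∧
      (∀ p : Fin 2 → ℝ, |p 0| = c → |p 1| = c → ∀ r : ℝ, 0 < r → r < min c (Real.pi - c) →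
      ∃ n₀ : ℕ, ∀ n ≥ n₀, ∀ ψ : Fin n → Literature.MathematicalPhysics.QuantumLattice.Fock
      (Literature.MathematicalPhysics.QuantumLattice.Orb
      (Literature.MathematicalPhysics.QuantumLattice.FermionTorus 2 L)),
      (∀ i : Fin n, Literature.MathematicalPhysics.QuantumLattice.IsGroundStateInSector
      (Literature.MathematicalPhysics.QuantumLattice.spinTwistedHubbardTorus L U
      (fun ν : Fin 2 => p ν + r * (if ν = 0 then Real.cos (2 * Real.pi * (i : ℕ) / n)
      else Real.sin (2 * Real.pi * (i : ℕ) / n))))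
      (2 * ⌊(1 - δ) * (L : ℝ) ^ 2 / 2⌋₊) 0 (ψ i) ∧ star (ψ i) ⬝ᵥ ψ i = 1) →
      (∏ i : Fin n, star (ψ i) ⬝ᵥ ψ (finRotate n i)).re < 0)) →
      (∀ χ₁ χ₂ : Literature.MathematicalPhysics.QuantumLattice.Fock
      (Literature.MathematicalPhysics.QuantumLattice.Orb
      (Literature.MathematicalPhysics.QuantumLattice.FermionTorus 2 L)),
      Literature.MathematicalPhysics.QuantumLattice.IsGroundStateInSector
      (Literature.MathematicalPhysics.QuantumLattice.hubbardTorus 2 L 1 U)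
      (2 * ⌊(1 - δ) * (L : ℝ) ^ 2 / 2⌋₊) 0 χ₁ →
      Literature.MathematicalPhysics.QuantumLattice.IsGroundStateInSector
      (Literature.MathematicalPhysics.QuantumLattice.hubbardTorus 2 L 1 U)
      (2 * ⌊(1 - δ) * (L : ℝ) ^ 2 / 2⌋₊) 0 χ₂ →
      ∃ z : ℂ, χ₂ = z • χ₁) →
      ∀ χ : Literature.MathematicalPhysics.QuantumLattice.Fock
      (Literature.MathematicalPhysics.QuantumLattice.Orb
      (Literature.MathematicalPhysics.QuantumLattice.FermionTorus 2 L)),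
      Literature.MathematicalPhysics.QuantumLattice.IsGroundStateInSector
      (Literature.MathematicalPhysics.QuantumLattice.hubbardTorus 2 L 1 U)
      (2 * ⌊(1 - δ) * (L : ℝ) ^ 2 / 2⌋₊) 0 χ →
      star χ ⬝ᵥ χ = 1 →
      c₀ * (L : ℝ) ^ 4 ≤ (Literature.MathematicalPhysics.QuantumLattice.expect
      ((Literature.MathematicalPhysics.QuantumLattice.pairField
      Literature.MathematicalPhysics.QuantumLattice.dWaveFormFactor L)ᴴ *
      Literature.MathematicalPhysics.QuantumLattice.pairField
      Literature.MathematicalPhysics.QuantumLattice.dWaveFormFactor L) χ).re) →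
    (∃ U₂ : ℝ, 0 < U₂ ∧ ∀ U ∈ Set.Ioo (0 : ℝ) U₂, ∃ (e' : ℝ → ℝ) (μ₁ μ₂ : ℝ), μ₁ ≤ μ₂ ∧
      (∀ μ' ∈ Set.Icc μ₁ μ₂, HasDerivAt (fun ν : ℝ => limUnder Filter.atTop (fun L : ℕ =>
      (Literature.MathematicalPhysics.QuantumLattice.hubbardTorusWith 2 (L + 1) 1 U ν).groundEnergy /
      ((L + 1 : ℕ) : ℝ) ^ 2)) (e' μ') μ') ∧
      -e' μ₁ ≤ 1 - 3 / 10 ∧ 1 - 1 / 10 ≤ -e' μ₂) →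
    Summit.HubbardSuperconductivity.HubbardSuperconductivity.Theses.AposterioriCapRg.SsbToEvenTorusLro →
    Summit.HubbardSuperconductivity.HubbardSuperconductivity.Theses.NodalDiracTwist.BridgeNodalToDWave := by
  intro hC hEOS h1315
  have hD1 := stub_subsequenceOrderForcesSSB
  have hD3a := stub_sourcedEnergyDensityLimit
  have hD3b := stub_energyMatchingOfDensityMatching
  obtain ⟨U₀, hU₀, h1⟩ := nodalOrderAlongSubsequence_of_classificationCore hC
  obtain ⟨U₂, hU₂, h3⟩ := densityMatched_of_regularEOS hEOS
  refine ⟨min U₀ U₂, lt_min hU₀ hU₂, ?_⟩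
  intro U hU δ hδ hND N ψ hyp
  have hU0 : U ∈ Set.Ioo (0 : ℝ) U₀ := ⟨hU.1, lt_of_lt_of_le hU.2 (min_le_left _ _)⟩
  have hU2 : U ∈ Set.Ioo (0 : ℝ) U₂ := ⟨hU.1, lt_of_lt_of_le hU.2 (min_le_right _ _)⟩
  obtain ⟨c, hc, hfreq⟩ := h1 U hU0 δ hδ hND N ψ hyp
  obtain ⟨μ, hDM⟩ := h3 U hU2 δ hδ
  have hEM := hD3b U δ μ hU.1 hδ hDM
  have hTL := fun h (hh : (0 : ℝ) ≤ h) => hD3a U μ h hU.1.le hh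
  have hOrder : HasDWaveOrder U μ := hD1 U δ μ hU.1 hδ hTL hEM N ψ hyp ⟨c, hc, hfreq⟩
  have hδ' : δ ∈ Set.Ioo (0 : ℝ) 1 := ⟨by linarith [hδ.1], by linarith [hδ.2]⟩
  exact h1315 U δ μ hU.1 hδ' hDM hOrder N ψ hyp

end Summit.HubbardSuperconductivity.HubbardSuperconductivity.Theorems.NodalDiracTwist.BridgeNodalToDWave
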